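import Literature.NumberTheory.LFunctions.WeilBochnerRepresentationRH
import Literature.NumberTheory.LFunctions.WeilBochnerRepresentationGRH
import Literature.NumberTheory.LFunctions.WeilZeroSum
import Literature.NumberTheory.LFunctions.DirichletLogDerivDisc
import HarnessLib

/-!
# rh-explicit (venture WeilGRH): MASS BOUNDS ARE MULTIPLICITY AND COUNT BOUNDS — `m(ρ) ≤ ν_ζ(S)` and
  `#T ≤ ν_ζ(S)` for zeros with ordinate in `S` (unconditionally; `χ`-twins included)

Cell `rh-explicit`, WEIL TRACK (structure seat weil-3, gen16).  The rigidity certificates of the track bound the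
mass `μ(S)` of every (ℕ-valued) Weil measure of a rung on blocks and windows `S` (`μ[l, r] = 0`, `μ(W) < 2`,
`μ[0, R] ≤ 6`, …).  Under RH the zero-height measure `ν_ζ = Σ_ρ m(ρ) δ_{Im ρ}` is such a measure
(`ZeroHeightMeasuresNatValued`), and this file turns its mass bounds into statements about the zeros themselves,
with NO hypothesis (the measure `ν_ζ` is defined unconditionally):

* `toNat_order_le_zetaZeroHeightMeasure`: `m(ρ) ≤ ν_ζ(S)` whenever `Im ρ ∈ S`;
* `riemannZetaZeroOrder_le_of_measureReal_le` / `…_eq_one_of_measureReal_le_one`: `ν_ζ(S) ≤ k` ⟹ `m(ρ) ≤ k`;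
  `ν_ζ(S) ≤ 1` ⟹ every zero with ordinate in `S` is SIMPLE;
* `card_le_zetaZeroHeightMeasure` / `card_le_of_measureReal_le`: a finite set of distinct non-trivial zeros with
  ordinates in `S` has at most `ν_ζ(S)` elements;
* the same for `ν_χ` and `m_χ = DirichletDisc.zeroOrder χ` (`χ ≠ 1`).

So a window certificate «`μ(W) < 2` for every ℕ-valued Weil measure» reads, under RH, «at most one zero of `ζ` has
its ordinate in `W`, and it is simple», and «`μ[0, R] ≤ 6`» reads «`N(R) ≤ 6` with multiplicity».
No definitions, no named facts, standard axioms; nothing here bears on the truth of RH.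
-/

set_option autoImplicit false

noncomputable section

open Complex Set MeasureTheory
open scoped Real ENNReal

namespace Summit.Ventures.WeilGRH

open Literature.NumberTheory.LFunctions
open Literature.NumberTheory.LFunctions.ZetaZeros (riemannZetaNontrivialZeros)
open Literature.NumberTheory.LFunctions.ExplicitPsiChar
open Literature.NumberTheory.LFunctions.WeilBochner (zetaZeroHeightMeasure charZeroHeightMeasure)

/-! ## `ν_ζ` -/

/-- **`m(ρ) ≤ ν_ζ(S)`** for every non-trivial zero `ρ` with `Im ρ ∈ S` (the Dirac mass at `Im ρ` with weight
`m(ρ)` is one term of `ν_ζ`). -/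
theorem toNat_order_le_zetaZeroHeightMeasure {ρ : ℂ} (hρ : ρ ∈ riemannZetaNontrivialZeros) {S : Set ℝ}
    (hmem : ρ.im ∈ S) : ((riemannZetaZeroOrder ρ).toNat : ℝ≥0∞) ≤ zetaZeroHeightMeasure S := by
  have hle : ((riemannZetaZeroOrder ρ).toNat : ℝ≥0∞) • Measure.dirac ρ.im ≤ zetaZeroHeightMeasure := by
    rw [zetaZeroHeightMeasure]
    exact Measure.le_sum (fun ρ' : riemannZetaNontrivialZeros ↦
      ((riemannZetaZeroOrder (ρ' : ℂ)).toNat : ℝ≥0∞) • Measure.dirac (ρ' : ℂ).im) ⟨ρ, hρ⟩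
  have hdirac : (1 : ℝ≥0∞) ≤ Measure.dirac ρ.im S := by
    have h := Measure.le_dirac_apply (a := ρ.im) (s := S)
    rwa [indicator_of_mem hmem, Pi.one_apply] at h
  calc ((riemannZetaZeroOrder ρ).toNat : ℝ≥0∞) = (riemannZetaZeroOrder ρ).toNat * 1 := (mul_one _).symm
    _ ≤ ((riemannZetaZeroOrder ρ).toNat : ℝ≥0∞) * Measure.dirac ρ.im S := mul_le_mul' le_rfl hdirac
    _ = (((riemannZetaZeroOrder ρ).toNat : ℝ≥0∞) • Measure.dirac ρ.im) S := by
        rw [Measure.smul_apply, smul_eq_mul]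
    _ ≤ zetaZeroHeightMeasure S := Measure.le_iff'.1 hle _

/-- **A mass bound is a multiplicity bound**: `ν_ζ(S) ≤ k` (finite) and `Im ρ ∈ S` ⟹ `m(ρ) ≤ k`. -/
theorem riemannZetaZeroOrder_le_of_measureReal_le {ρ : ℂ} (hρ : ρ ∈ riemannZetaNontrivialZeros) {S : Set ℝ}
    (hmem : ρ.im ∈ S) (hfin : zetaZeroHeightMeasure S ≠ ⊤) {k : ℕ} (hle : zetaZeroHeightMeasure.real S ≤ k) :
    riemannZetaZeroOrder ρ ≤ k := by
  have h := ENNReal.toReal_mono hfin (toNat_order_le_zetaZeroHeightMeasure hρ hmem)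
  rw [ENNReal.toReal_natCast, ← measureReal_def] at h
  have hk : (riemannZetaZeroOrder ρ).toNat ≤ k := by exact_mod_cast h.trans hle
  have h0 := ZetaZeros.riemannZetaNontrivialZeros.one_le_order hρ
  omega

/-- ★ **MASS AT MOST ONE ⟹ SIMPLE**: if `ν_ζ(S) ≤ 1` (finite), every non-trivial zero of `ζ` with ordinate in `S`
is simple. -/
theorem riemannZetaZeroOrder_eq_one_of_measureReal_le_one {ρ : ℂ} (hρ : ρ ∈ riemannZetaNontrivialZeros)
    {S : Set ℝ} (hmem : ρ.im ∈ S) (hfin : zetaZeroHeightMeasure S ≠ ⊤) (hle : zetaZeroHeightMeasure.real S ≤ 1) :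
    riemannZetaZeroOrder ρ = 1 := by
  have h1 := riemannZetaZeroOrder_le_of_measureReal_le hρ hmem hfin (k := 1) (by rwa [Nat.cast_one])
  have h0 := ZetaZeros.riemannZetaNontrivialZeros.one_le_order hρ
  push_cast at h1
  exact le_antisymm h1 h0

/-- **A mass bound is a count bound**: a finite set `T` of distinct non-trivial zeros of `ζ` with ordinates in `S`
has `#T ≤ ν_ζ(S)`. -/
theorem card_le_zetaZeroHeightMeasure (T : Finset ℂ) {S : Set ℝ} (hS : MeasurableSet S)
    (hT : ∀ ρ ∈ T, ρ ∈ riemannZetaNontrivialZeros ∧ ρ.im ∈ S) :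
    (T.card : ℝ≥0∞) ≤ zetaZeroHeightMeasure S := by
  classical
  -- the sub-family of `ν_ζ` indexed by `T`
  set T' : Finset riemannZetaNontrivialZeros := T.attach.image fun ρ ↦ ⟨ρ.1, (hT ρ.1 ρ.2).1⟩ with hT'
  have hcard : T'.card = T.card := by
    rw [hT', Finset.card_image_of_injective _ (fun x y h ↦ Subtype.ext (by simpa using congrArg Subtype.val h)),
      Finset.card_attach]
  rw [zetaZeroHeightMeasure, Measure.sum_apply _ hS, ← hcard]
  calc ((T'.card : ℕ) : ℝ≥0∞) = ∑ ρ ∈ T', (1 : ℝ≥0∞) := by simp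
    _ ≤ ∑ ρ ∈ T', (((riemannZetaZeroOrder (ρ : ℂ)).toNat : ℝ≥0∞) • Measure.dirac (ρ : ℂ).im) S := by
        refine Finset.sum_le_sum fun ρ hρ' ↦ ?_
        obtain ⟨ρ₀, -, rfl⟩ := Finset.mem_image.1 hρ'
        have hmem : (ρ₀ : ℂ).im ∈ S := (hT ρ₀.1 ρ₀.2).2
        have hord : (1 : ℝ≥0∞) ≤ ((riemannZetaZeroOrder (ρ₀ : ℂ)).toNat : ℝ≥0∞) := by
          have h := ZetaZeros.riemannZetaNontrivialZeros.one_le_order (hT ρ₀.1 ρ₀.2).1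
          have : 1 ≤ (riemannZetaZeroOrder (ρ₀ : ℂ)).toNat := by omega
          exact_mod_cast this
        rw [Measure.smul_apply, smul_eq_mul, Measure.dirac_apply' _ hS, indicator_of_mem hmem, Pi.one_apply,
          mul_one]
        exact hord
    _ ≤ ∑' ρ : riemannZetaNontrivialZeros,
          (((riemannZetaZeroOrder (ρ : ℂ)).toNat : ℝ≥0∞) • Measure.dirac (ρ : ℂ).im) S := ENNReal.sum_le_tsum _

/-- `ν_ζ(S) ≤ k` (finite) ⟹ at most `k` distinct non-trivial zeros of `ζ` have their ordinate in `S`. -/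
theorem card_le_of_measureReal_le (T : Finset ℂ) {S : Set ℝ} (hS : MeasurableSet S)
    (hT : ∀ ρ ∈ T, ρ ∈ riemannZetaNontrivialZeros ∧ ρ.im ∈ S) (hfin : zetaZeroHeightMeasure S ≠ ⊤) {k : ℕ}
    (hle : zetaZeroHeightMeasure.real S ≤ k) : T.card ≤ k := by
  have h := ENNReal.toReal_mono hfin (card_le_zetaZeroHeightMeasure T hS hT)
  rw [ENNReal.toReal_natCast, ← measureReal_def] at h
  exact_mod_cast h.trans hle

/-! ## `ν_χ` -/

section Char

variable {q : ℕ} [NeZero q] {χ : DirichletCharacter ℂ q}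

/-- **`m_χ(ρ) ≤ ν_χ(S)`** for every non-trivial zero `ρ` of `L(s, χ)` with `Im ρ ∈ S`. -/
theorem natCast_zeroOrder_le_charZeroHeightMeasure {ρ : ℂ} (hρ : ρ ∈ charNontrivialZeros χ) {S : Set ℝ}
    (hmem : ρ.im ∈ S) : ((DirichletDisc.zeroOrder χ ρ : ℕ) : ℝ≥0∞) ≤ charZeroHeightMeasure χ S := by
  have hle : ((DirichletDisc.zeroOrder χ ρ : ℕ) : ℝ≥0∞) • Measure.dirac ρ.im ≤ charZeroHeightMeasure χ := by
    rw [charZeroHeightMeasure]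
    exact Measure.le_sum (fun ρ' : charNontrivialZeros χ ↦
      ((DirichletDisc.zeroOrder χ (ρ' : ℂ) : ℕ) : ℝ≥0∞) • Measure.dirac (ρ' : ℂ).im) ⟨ρ, hρ⟩
  have hdirac : (1 : ℝ≥0∞) ≤ Measure.dirac ρ.im S := by
    have h := Measure.le_dirac_apply (a := ρ.im) (s := S)
    rwa [indicator_of_mem hmem, Pi.one_apply] at h
  calc ((DirichletDisc.zeroOrder χ ρ : ℕ) : ℝ≥0∞) = (DirichletDisc.zeroOrder χ ρ : ℕ) * 1 := (mul_one _).symm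
    _ ≤ ((DirichletDisc.zeroOrder χ ρ : ℕ) : ℝ≥0∞) * Measure.dirac ρ.im S := mul_le_mul' le_rfl hdirac
    _ = (((DirichletDisc.zeroOrder χ ρ : ℕ) : ℝ≥0∞) • Measure.dirac ρ.im) S := by
        rw [Measure.smul_apply, smul_eq_mul]
    _ ≤ charZeroHeightMeasure χ S := Measure.le_iff'.1 hle _

/-- `ν_χ(S) ≤ k` (finite), `Im ρ ∈ S` ⟹ `m_χ(ρ) ≤ k`; with `k = 1` and `χ ≠ 1` the zero is simple
(`m_χ(ρ) ≥ 1` by `DirichletDisc.zeroOrder_pos_iff`). -/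
theorem zeroOrder_le_of_measureReal_le {ρ : ℂ} (hρ : ρ ∈ charNontrivialZeros χ) {S : Set ℝ}
    (hmem : ρ.im ∈ S) (hfin : charZeroHeightMeasure χ S ≠ ⊤) {k : ℕ}
    (hle : (charZeroHeightMeasure χ).real S ≤ k) : DirichletDisc.zeroOrder χ ρ ≤ k := by
  have h := ENNReal.toReal_mono hfin (natCast_zeroOrder_le_charZeroHeightMeasure hρ hmem)
  rw [ENNReal.toReal_natCast, ← measureReal_def] at h
  exact_mod_cast h.trans hle

/-- ★ `ν_χ(S) ≤ 1` (finite, `χ ≠ 1`) ⟹ every non-trivial zero of `L(s, χ)` with ordinate in `S` is simple. -/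
theorem zeroOrder_eq_one_of_measureReal_le_one (hχ : χ ≠ 1) {ρ : ℂ} (hρ : ρ ∈ charNontrivialZeros χ)
    {S : Set ℝ} (hmem : ρ.im ∈ S) (hfin : charZeroHeightMeasure χ S ≠ ⊤)
    (hle : (charZeroHeightMeasure χ).real S ≤ 1) : DirichletDisc.zeroOrder χ ρ = 1 := by
  have h1 := zeroOrder_le_of_measureReal_le hρ hmem hfin (k := 1) (by rwa [Nat.cast_one])
  have h0 : 0 < DirichletDisc.zeroOrder χ ρ := (DirichletDisc.zeroOrder_pos_iff χ hχ ρ).2 hρ.1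
  omega

/-- A finite set `T` of distinct non-trivial zeros of `L(s, χ)` (`χ ≠ 1`) with ordinates in `S` has
`#T ≤ ν_χ(S)`. -/
theorem card_le_charZeroHeightMeasure (hχ : χ ≠ 1) (T : Finset ℂ) {S : Set ℝ} (hS : MeasurableSet S)
    (hT : ∀ ρ ∈ T, ρ ∈ charNontrivialZeros χ ∧ ρ.im ∈ S) :
    (T.card : ℝ≥0∞) ≤ charZeroHeightMeasure χ S := by
  classical
  set T' : Finset (charNontrivialZeros χ) := T.attach.image fun ρ ↦ ⟨ρ.1, (hT ρ.1 ρ.2).1⟩ with hT'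
  have hcard : T'.card = T.card := by
    rw [hT', Finset.card_image_of_injective _ (fun x y h ↦ Subtype.ext (by simpa using congrArg Subtype.val h)),
      Finset.card_attach]
  rw [charZeroHeightMeasure, Measure.sum_apply _ hS, ← hcard]
  calc ((T'.card : ℕ) : ℝ≥0∞) = ∑ ρ ∈ T', (1 : ℝ≥0∞) := by simp
    _ ≤ ∑ ρ ∈ T', (((DirichletDisc.zeroOrder χ (ρ : ℂ) : ℕ) : ℝ≥0∞) • Measure.dirac (ρ : ℂ).im) S := by
        refine Finset.sum_le_sum fun ρ hρ' ↦ ?_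
        obtain ⟨ρ₀, -, rfl⟩ := Finset.mem_image.1 hρ'
        have hmem : (ρ₀ : ℂ).im ∈ S := (hT ρ₀.1 ρ₀.2).2
        have hord : (1 : ℝ≥0∞) ≤ ((DirichletDisc.zeroOrder χ (ρ₀ : ℂ) : ℕ) : ℝ≥0∞) := by
          have h : 0 < DirichletDisc.zeroOrder χ (ρ₀ : ℂ) :=
            (DirichletDisc.zeroOrder_pos_iff χ hχ _).2 (hT ρ₀.1 ρ₀.2).1.1
          exact_mod_cast h
        rw [Measure.smul_apply, smul_eq_mul, Measure.dirac_apply' _ hS, indicator_of_mem hmem, Pi.one_apply,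
          mul_one]
        exact hord
    _ ≤ ∑' ρ : charNontrivialZeros χ,
          (((DirichletDisc.zeroOrder χ (ρ : ℂ) : ℕ) : ℝ≥0∞) • Measure.dirac (ρ : ℂ).im) S := ENNReal.sum_le_tsum _

end Char

end Summit.Ventures.WeilGRH

end
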